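import Literature.AnabelianGeometry.SemiGraphs.TemperedCompactPairUnfoldedCrossing
import Literature.AnabelianGeometry.SemiGraphs.TemperedCompactInVerticialAtOfPersistentLocFin
import Literature.AnabelianGeometry.SemiGraphs.TemperedHbddOfLocallyFinite
import HarnessLib

/-!
# Persistent unfolded fixed branch pairs over ONE level vertex live over a base vertex of INFINITE valence;
# at a locally finite graph two compact subgroups of `π₁^temp(𝒢)` meeting non-trivially are jointly compact
# or anchored

Mochizuki, *Semi-graphs of anabelioids*, Publ. RIMS **42** (2006), §3, Theorem 3.7 (iii)/(iv) pp. 40–41, with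
the author's *Comments* (2020) (6)(b) ("the subjoints … converge, in the profinite topology, to some profinite
subjoint … a contradiction, in light of our assumption that `𝒢` is totally estranged")
[cite: MochizukiSemiAnbd2006, Thm 3.7(iv) p.41].

PROOF-ONLY tool file (abc-iut cell, layer L3, row «T37iv-S2@RELATIVE-BRIDGE», file F4, seat abc-iut-L3-t8 gen 10;
no definition, no named fact).  Closes the third regime of the trichotomy (F1 `TemperedCompactPairBridgeRelative`,
F2 `TemperedCompactPairDistanceOne`, F3 `TemperedCompactPairSeparatingEdge` / `TemperedCompactPairUnfoldedCrossing`)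
with TOTAL ESTRANGEMENT: for every countable `𝒢` satisfying the hypotheses of Thm 3.7, canonical tower,

* `eventually_no_unfolded_pair_over_temperedPiChart` — abc-iut-w6-d066's `eventually_no_unfolded_pair_over`
  (Kőnig on the finite level fibres + total estrangement through (I4′)_cpt) INSTANTIATED at the canonical tower
  for an ARBITRARY `𝒢` (the binders are abc-iut-L3-t2/t8/t11's tower lemmas; no local finiteness is consumed):
  for a compact `C ≠ 1`, a given branch pair of the finite level `𝔾_{S j}` is the image of a `C`-fixed unfolded
  tree branch pair of `𝒢_{∞,k}` for only finitely many `k`;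
* `finite_levelStar_of_finite_star` — the star of a level vertex over a base vertex of finite valence is finite;
* ★ `not_finite_star_of_forall_unfolded` — if a compact `C ≠ 1` fixes, at EVERY level `M ≥ m`, a vertex of
  `𝒢_{∞,M}` over the vertex `z` of `𝒢_{∞,m}` together with two of its branches whose images are DISTINCT branches
  at `z`, then the base vertex under `z` has INFINITELY many branches (pigeonhole over the finitely many level
  pairs at the image of `z` in `𝔾_{S m}`);
* ★★ `anchored_or_infinite_valence_of_not_isCompact` — for COMPACT `K₁, K₂ ≤ π₁^temp(𝒢)` with `K₁ ⊓ K₂ ≠ 1`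
  and `(K₁ ⊔ K₂)‾` NOT compact: EITHER both lie in verticial subgroups with `K₁ ⊓ K₂` in an edge-like subgroup,
  OR the persistent unfolded `K₁ ⊓ K₂`-fixed pairs of F3 sit over a base vertex of INFINITE valence — the exact
  residual of the second sentence of Thm 3.7 (iv) in the cell's ∀-countable typing;
* ★★ `isCompact_or_anchored_of_isLocallyFinite` — at a LOCALLY FINITE Thm-3.7 graph the third regime is EMPTY:
  two compact subgroups meeting non-trivially generate a compact subgroup or are anchored (a bridge-free second
  route to the isolation of exotic maximal compact subgroups, abc-iut-L3-t8 gen 9 p524853).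

Honest framing: generic statements about OUR typed `π₁^temp` (canonical chart); print's Thm 3.7 concerns the
graphs of [SemiAnbd]; nothing here bears on [IUTchIII] Cor. 3.12; no side taken; typed ≠ proved elsewhere.
-/
noncomputable section

open CategoryTheory Topology

namespace Literature.AnabelianGeometry.SemiGraphs

open SimpleGraph

universe u

namespace ProfiniteSemiGraph

variable {𝒢 : ProfiniteSemiGraph.{u}}

/-! ### `eventually_no_unfolded_pair_over` at the canonical tower, arbitrary `𝒢` -/

/-- **Only finitely many levels carry a `C`-fixed unfolded tree branch pair over a given level branch pair**
(abc-iut-w6-d066's `eventually_no_unfolded_pair_over` at the canonical tower of an ARBITRARY `𝒢` satisfying the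
hypotheses of Thm 3.7: levels = the orbit graphs `𝔾_{S n}`, immersions `treeQuot`, finite fibres of the finite
coverings `S n`, (I4′)_cpt = `stabBranchPairCpt'_temperedPiChart` with (I0v) `galoisLevelData_faithfulV`).
[cite: MochizukiSemiAnbd2006, Thm 3.7(iii) p.41] -/
theorem eventually_no_unfolded_pair_over_temperedPiChart (h37 : 𝒢.Thm37Hypotheses)
    (C : Subgroup (𝒢.temperedPiChart h37.toProp36Hypotheses).G)
    (hC : IsCompact (C : Set (𝒢.temperedPiChart h37.toProp36Hypotheses).G)) (hC1 : C ≠ ⊥) (j : ℕ)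
    (w₀ : ((𝒢.galoisLevelData h37.toProp36Hypotheses).S j).orbitGraph.Vertex)
    (β₀ β₀' : ((𝒢.galoisLevelData h37.toProp36Hypotheses).S j).orbitGraph.Branch) (hβ : β₀ ≠ β₀') :
    ∃ (k₀ : ℕ) (h₀ : j ≤ k₀), ∀ (k : ℕ) (hk : k₀ ≤ k),
      ¬ ∃ (w : ((𝒢.galoisLevelData h37.toProp36Hypotheses).tree k).Vertex)
          (cc cc' : ((𝒢.galoisLevelData h37.toProp36Hypotheses).tree k).Branch), cc ≠ cc' ∧
        ((𝒢.galoisLevelData h37.toProp36Hypotheses).tree k).abuts cc = some w ∧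
        ((𝒢.galoisLevelData h37.toProp36Hypotheses).tree k).abuts cc' = some w ∧
        (∀ g ∈ C, ((𝒢.galoisLevelData h37.toProp36Hypotheses).treeAct h37.toProp36Hypotheses.isCountable k
              g).hom.vertexMap w = w ∧
          ((𝒢.galoisLevelData h37.toProp36Hypotheses).treeAct h37.toProp36Hypotheses.isCountable k
              g).hom.branchMap cc = cc ∧
          ((𝒢.galoisLevelData h37.toProp36Hypotheses).treeAct h37.toProp36Hypotheses.isCountable k
              g).hom.branchMap cc' = cc') ∧
        ((𝒢.galoisLevelData h37.toProp36Hypotheses).levelTrans (h₀.trans hk)).vertexMap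
            (((𝒢.galoisLevelData h37.toProp36Hypotheses).treeQuot k).vertexMap w) = w₀ ∧
        ((𝒢.galoisLevelData h37.toProp36Hypotheses).levelTrans (h₀.trans hk)).branchMap
            (((𝒢.galoisLevelData h37.toProp36Hypotheses).treeQuot k).branchMap cc) = β₀ ∧
        ((𝒢.galoisLevelData h37.toProp36Hypotheses).levelTrans (h₀.trans hk)).branchMap
            (((𝒢.galoisLevelData h37.toProp36Hypotheses).treeQuot k).branchMap cc') = β₀' := by
  let h36 := h37.toProp36Hypotheses
  let G := 𝒢.galoisLevelData h36
  exact (verticialLevelData_temperedPiChart (h36 := h36)).eventually_no_unfolded_pair_over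
    (fun n => (G.S n).orbitGraph) (fun n => G.treeQuot n)
    (fun n => (G.levelAct h36.isCountable (𝒢.galoisLevelData_hconn h36) n).comp (MonoidHom.id _))
    (fun _ _ h => G.levelTrans h) (fun n => (G.S n).orbitGraphProj) h37 C hC1
    (fun n => G.treeQuot_isImmersion n)
    (fun n g => G.treeQuot_act h36.isCountable (𝒢.galoisLevelData_hconn h36) n g)
    (fun _ _ h => G.treeTrans_quot h) (fun n => G.levelTrans_self n) (fun _ _ _ hij hjk => G.levelTrans_comp hij hjk)
    (fun _ _ h => G.levelTrans_proj h)
    (fun n w => (G.S n).finite_oVertex_over (𝒢.galoisLevelData_isFinite h36 n) w)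
    (fun n b => (G.S n).finite_orbitGraph_branch_over (𝒢.galoisLevelData_isFinite h36 n) b)
    (fun j₀ w β β' hpair hcompat =>
      𝒢.stabBranchPairCpt'_temperedPiChart h36 (galoisLevelData_faithfulV 𝒢 h37) C hC j₀ w β β' hpair hcompat)
    j w₀ β₀ β₀' hβ

/-- **The star of a level vertex over a base vertex of finite valence is finite** (the branch fibres of the
finite covering `S n` are finite). [cite: MochizukiSemiAnbd2006, Def 3.5(i) p.37] -/
theorem finite_levelStar_of_finite_star (h36 : 𝒢.Prop36Hypotheses) (n : ℕ)
    (w₀ : ((𝒢.galoisLevelData h36).S n).orbitGraph.Vertex)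
    (hv : {b : 𝒢.graph.Branch |
      𝒢.graph.abuts b = some (((𝒢.galoisLevelData h36).S n).orbitGraphProj.vertexMap w₀)}.Finite) :
    {β : ((𝒢.galoisLevelData h36).S n).orbitGraph.Branch |
      ((𝒢.galoisLevelData h36).S n).orbitGraph.abuts β = some w₀}.Finite := by
  refine ((hv.biUnion fun b _ => ((𝒢.galoisLevelData h36).S n).finite_orbitGraph_branch_over
    (𝒢.galoisLevelData_isFinite h36 n) b)).subset ?_
  intro β hβ
  simp only [Set.mem_iUnion, Set.mem_setOf_eq, exists_prop]
  exact ⟨((𝒢.galoisLevelData h36).S n).orbitGraphProj.branchMap β,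
    ((𝒢.galoisLevelData h36).S n).orbitGraphProj.abuts_branchMap β w₀ hβ, rfl⟩

/-! ### ★ Persistent unfolded pairs force infinite valence -/

/-- ★ **Persistent unfolded `C`-fixed branch pairs over ONE level vertex force INFINITE valence below it.**  Let
`C ≤ π₁^temp(𝒢)` be compact, `C ≠ 1`, and `z` a vertex of `𝒢_{∞,m}` such that EVERY level `M ≥ m` carries a vertex
over `z` with two `C`-fixed branches at it (the vertex `C`-fixed too) whose images in `𝒢_{∞,m}` are DISTINCT
branches at `z`.  Then the base vertex under `z` has infinitely many branches: otherwise the image of `z` in the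
finite level `𝔾_{S m}` has a finite star (`finite_levelStar_of_finite_star`), each of the finitely many branch
pairs there is realised at only finitely many levels (`eventually_no_unfolded_pair_over_temperedPiChart`), and a
level beyond all of them contradicts the hypothesis (images pushed to `𝔾_{S m}` along `treeTrans_quot`; distinct
there since `treeQuot` is an immersion). [cite: MochizukiSemiAnbd2006, Thm 3.7(iv) p.41] -/
theorem not_finite_star_of_forall_unfolded (h37 : 𝒢.Thm37Hypotheses)
    (C : Subgroup ((𝒢.galoisLevelData h37.toProp36Hypotheses).temperedPi h37.toProp36Hypotheses.isCountable))
    (hC : IsCompact (C : Set ((𝒢.galoisLevelData h37.toProp36Hypotheses).temperedPi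
      h37.toProp36Hypotheses.isCountable))) (hC1 : C ≠ ⊥) (m : ℕ)
    (z : ((𝒢.galoisLevelData h37.toProp36Hypotheses).tree m).Vertex)
    (hunf : ∀ (M : ℕ) (hmM : m ≤ M),
      ∃ (w : ((𝒢.galoisLevelData h37.toProp36Hypotheses).tree M).Vertex)
        (β β' : ((𝒢.galoisLevelData h37.toProp36Hypotheses).tree M).Branch),
        ((𝒢.galoisLevelData h37.toProp36Hypotheses).tree M).abuts β = some w ∧
        ((𝒢.galoisLevelData h37.toProp36Hypotheses).tree M).abuts β' = some w ∧
        ((𝒢.galoisLevelData h37.toProp36Hypotheses).treeTrans hmM).vertexMap w = z ∧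
        ((𝒢.galoisLevelData h37.toProp36Hypotheses).treeTrans hmM).branchMap β ≠
          ((𝒢.galoisLevelData h37.toProp36Hypotheses).treeTrans hmM).branchMap β' ∧
        ∀ g ∈ C,
          ((𝒢.galoisLevelData h37.toProp36Hypotheses).treeAct h37.toProp36Hypotheses.isCountable M
              g).hom.vertexMap w = w ∧
          ((𝒢.galoisLevelData h37.toProp36Hypotheses).treeAct h37.toProp36Hypotheses.isCountable M
              g).hom.branchMap β = β ∧
          ((𝒢.galoisLevelData h37.toProp36Hypotheses).treeAct h37.toProp36Hypotheses.isCountable M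
              g).hom.branchMap β' = β') :
    ¬ {b : 𝒢.graph.Branch | 𝒢.graph.abuts b =
        some (((𝒢.galoisLevelData h37.toProp36Hypotheses).treeProj m).vertexMap z)}.Finite := by
  classical
  intro hfin
  let h36 := h37.toProp36Hypotheses
  let G := 𝒢.galoisLevelData h36
  have hc := h36.isCountable
  let L := (G.S m).orbitGraph
  let q : G.tree m ⟶ L := G.treeQuot m
  let w₀ : L.Vertex := q.vertexMap z
  -- the star of `w₀` in the finite level is finite
  have hv : {b : 𝒢.graph.Branch | 𝒢.graph.abuts b = some ((G.S m).orbitGraphProj.vertexMap w₀)}.Finite := by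
    have e : (G.S m).orbitGraphProj.vertexMap w₀ = (G.treeProj m).vertexMap z := rfl
    rw [e]; exact hfin
  have hstar : {β : L.Branch | L.abuts β = some w₀}.Finite := finite_levelStar_of_finite_star h36 m w₀ hv
  let Q : Set (L.Branch × L.Branch) := {τ | L.abuts τ.1 = some w₀ ∧ L.abuts τ.2 = some w₀}
  have hQ : Q.Finite := (hstar.prod hstar).subset fun τ hτ => ⟨hτ.1, hτ.2⟩
  -- one level beyond which none of the pairs of `Q` is realised by a `C`-fixed unfolded tree pair
  have hB := fun (τ : L.Branch × L.Branch) (hτ : τ.1 ≠ τ.2) =>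
    eventually_no_unfolded_pair_over_temperedPiChart h37 C hC hC1 m w₀ τ.1 τ.2 hτ
  let kk : L.Branch × L.Branch → ℕ := fun τ => if hτ : τ.1 ≠ τ.2 then (hB τ hτ).choose else m
  have hkk : ∀ τ (hτ : τ.1 ≠ τ.2), ∃ h₀ : m ≤ kk τ, ∀ (k : ℕ) (hk : kk τ ≤ k),
      ¬ ∃ (w : (G.tree k).Vertex) (cc cc' : (G.tree k).Branch), cc ≠ cc' ∧
        (G.tree k).abuts cc = some w ∧ (G.tree k).abuts cc' = some w ∧
        (∀ g ∈ C, (G.treeAct hc k g).hom.vertexMap w = w ∧ (G.treeAct hc k g).hom.branchMap cc = cc ∧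
          (G.treeAct hc k g).hom.branchMap cc' = cc') ∧
        (G.levelTrans (h₀.trans hk)).vertexMap ((G.treeQuot k).vertexMap w) = w₀ ∧
        (G.levelTrans (h₀.trans hk)).branchMap ((G.treeQuot k).branchMap cc) = τ.1 ∧
        (G.levelTrans (h₀.trans hk)).branchMap ((G.treeQuot k).branchMap cc') = τ.2 := by
    intro τ hτ
    have hdef : kk τ = (hB τ hτ).choose := dif_pos hτ
    obtain ⟨h₀, hspec⟩ := (hB τ hτ).choose_spec
    rw [hdef]
    exact ⟨h₀, fun k hk => hspec k hk⟩
  obtain ⟨K, hK⟩ := (hQ.image kk).bddAbove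
  let k : ℕ := max m K
  have hmk : m ≤ k := le_max_left _ _
  -- the unfolded pair of level `k` and its image pair `τ₀` in the finite level `𝔾_{S m}`
  obtain ⟨w, β, β', hβw, hβ'w, hwz, hne, hfix⟩ := hunf k hmk
  let π := G.treeTrans hmk
  let τ₀ : L.Branch × L.Branch := (q.branchMap (π.branchMap β), q.branchMap (π.branchMap β'))
  have hπβ : (G.tree m).abuts (π.branchMap β) = some z := by rw [π.abuts_branchMap β w hβw, hwz]
  have hπβ' : (G.tree m).abuts (π.branchMap β') = some z := by rw [π.abuts_branchMap β' w hβ'w, hwz]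
  have hτ₀Q : τ₀ ∈ Q := ⟨q.abuts_branchMap _ z hπβ, q.abuts_branchMap _ z hπβ'⟩
  have hτ₀ : τ₀.1 ≠ τ₀.2 := by
    intro h
    apply hne
    have hinj := G.treeQuot_isImmersion m z
    have h' : SemiGraph.Hom.starMap q z ⟨π.branchMap β, hπβ⟩ = SemiGraph.Hom.starMap q z ⟨π.branchMap β', hπβ'⟩ :=
      Subtype.ext h
    exact congrArg Subtype.val (hinj h')
  -- the chosen level `kk τ₀` is at most `K ≤ k`
  obtain ⟨h₀, hno⟩ := hkk τ₀ hτ₀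
  have hkK : kk τ₀ ≤ k := (hK ⟨τ₀, hτ₀Q, rfl⟩).trans (le_max_right _ _)
  refine hno k hkK ⟨w, β, β', fun h => hne (by rw [h]), hβw, hβ'w, hfix, ?_, ?_, ?_⟩
  · have e := congrArg (fun ψ => SemiGraph.Hom.vertexMap ψ w) (G.treeTrans_quot hmk)
    simp only [SemiGraph.comp_vertexMap, Function.comp_apply] at e
    rw [← e, hwz]
  · have e := congrArg (fun ψ => SemiGraph.Hom.branchMap ψ β) (G.treeTrans_quot hmk)
    simp only [SemiGraph.comp_branchMap, Function.comp_apply] at e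
    rw [← e]
  · have e := congrArg (fun ψ => SemiGraph.Hom.branchMap ψ β') (G.treeTrans_quot hmk)
    simp only [SemiGraph.comp_branchMap, Function.comp_apply] at e
    rw [← e]

/-! ### ★★ The residual of Thm 3.7 (iv), sentence 2, lives at infinite valence -/

/-- ★★ **Two compact subgroups meeting non-trivially: jointly compact, anchored, or over infinite valence.**
Let `𝒢` satisfy the hypotheses of Thm 3.7 and `K₁, K₂ ≤ π₁^temp(𝒢)` be COMPACT with `K₁ ⊓ K₂ ≠ 1` and
`(K₁ ⊔ K₂)‾` NOT compact.  Then EITHER `K₁`, `K₂` lie in verticial subgroups and `K₁ ⊓ K₂` in an edge-like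
subgroup, OR there are a level `m` and a vertex `z` of `𝒢_{∞,m}`, fixed by NEITHER `K₁` NOR `K₂`, lying over a
base vertex of INFINITE valence, over which every level `M ≥ m` carries an unfolded `K₁ ⊓ K₂`-fixed branch
pair (`anchored_or_unfolded_of_not_isCompact` + `not_finite_star_of_forall_unfolded`).
[cite: MochizukiSemiAnbd2006, Thm 3.7(iv) p.41] -/
theorem anchored_or_infinite_valence_of_not_isCompact (h37 : 𝒢.Thm37Hypotheses)
    (K₁ K₂ : Subgroup ((𝒢.galoisLevelData h37.toProp36Hypotheses).temperedPi h37.toProp36Hypotheses.isCountable))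
    (hK₁ : IsCompact (K₁ : Set ((𝒢.galoisLevelData h37.toProp36Hypotheses).temperedPi
      h37.toProp36Hypotheses.isCountable)))
    (hK₂ : IsCompact (K₂ : Set ((𝒢.galoisLevelData h37.toProp36Hypotheses).temperedPi
      h37.toProp36Hypotheses.isCountable)))
    (hne : K₁ ⊓ K₂ ≠ ⊥)
    (hK : ¬ IsCompact (((K₁ ⊔ K₂).topologicalClosure :
      Subgroup ((𝒢.galoisLevelData h37.toProp36Hypotheses).temperedPi h37.toProp36Hypotheses.isCountable)) :
        Set ((𝒢.galoisLevelData h37.toProp36Hypotheses).temperedPi h37.toProp36Hypotheses.isCountable))) :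
    ((∃ (v : 𝒢.graph.Vertex) (H : Subgroup (𝒢.temperedPiChart h37.toProp36Hypotheses).G),
        H ∈ verticialSubgroups (𝒢.temperedPiChart h37.toProp36Hypotheses) v ∧ K₁ ≤ H) ∧
      (∃ (v : 𝒢.graph.Vertex) (H : Subgroup (𝒢.temperedPiChart h37.toProp36Hypotheses).G),
        H ∈ verticialSubgroups (𝒢.temperedPiChart h37.toProp36Hypotheses) v ∧ K₂ ≤ H) ∧
      ∃ (e : 𝒢.graph.Edge) (L : Subgroup (𝒢.temperedPiChart h37.toProp36Hypotheses).G),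
        L ∈ edgeLikeSubgroups (𝒢.temperedPiChart h37.toProp36Hypotheses) e ∧ K₁ ⊓ K₂ ≤ L) ∨
    ∃ (m : ℕ) (z : ((𝒢.galoisLevelData h37.toProp36Hypotheses).tree m).Vertex),
      (¬ ∀ k ∈ K₁, ((𝒢.galoisLevelData h37.toProp36Hypotheses).treeAct h37.toProp36Hypotheses.isCountable m
          k).hom.vertexMap z = z) ∧
      (¬ ∀ k ∈ K₂, ((𝒢.galoisLevelData h37.toProp36Hypotheses).treeAct h37.toProp36Hypotheses.isCountable m
          k).hom.vertexMap z = z) ∧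
      ¬ {b : 𝒢.graph.Branch | 𝒢.graph.abuts b =
          some (((𝒢.galoisLevelData h37.toProp36Hypotheses).treeProj m).vertexMap z)}.Finite ∧
      ∀ (M : ℕ) (hmM : m ≤ M),
        ∃ (w : ((𝒢.galoisLevelData h37.toProp36Hypotheses).tree M).Vertex)
          (β β' : ((𝒢.galoisLevelData h37.toProp36Hypotheses).tree M).Branch),
          ((𝒢.galoisLevelData h37.toProp36Hypotheses).tree M).abuts β = some w ∧
          ((𝒢.galoisLevelData h37.toProp36Hypotheses).tree M).abuts β' = some w ∧
          ((𝒢.galoisLevelData h37.toProp36Hypotheses).treeTrans hmM).vertexMap w = z ∧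
          ((𝒢.galoisLevelData h37.toProp36Hypotheses).treeTrans hmM).branchMap β ≠
            ((𝒢.galoisLevelData h37.toProp36Hypotheses).treeTrans hmM).branchMap β' ∧
          ∀ d ∈ K₁ ⊓ K₂,
            ((𝒢.galoisLevelData h37.toProp36Hypotheses).treeAct h37.toProp36Hypotheses.isCountable M
                d).hom.vertexMap w = w ∧
            ((𝒢.galoisLevelData h37.toProp36Hypotheses).treeAct h37.toProp36Hypotheses.isCountable M
                d).hom.branchMap β = β ∧
            ((𝒢.galoisLevelData h37.toProp36Hypotheses).treeAct h37.toProp36Hypotheses.isCountable M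
                d).hom.branchMap β' = β' := by
  have h36 := h37.toProp36Hypotheses
  rcases anchored_or_unfolded_of_not_isCompact h36 K₁ K₂ hK₁ hK₂ hK with hanch | ⟨m, z, hz₁, hz₂, hunf⟩
  · exact Or.inl hanch
  · haveI : T2Space ((𝒢.galoisLevelData h36).temperedPi h36.isCountable) :=
      (𝒢.galoisLevelData h36).t2Space_temperedPi h36.isCountable
    have hCc : IsCompact ((K₁ ⊓ K₂ : Subgroup _) :
        Set ((𝒢.galoisLevelData h36).temperedPi h36.isCountable)) := by
      rw [Subgroup.coe_inf]
      exact hK₁.inter_right hK₂.isClosed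
    exact Or.inr ⟨m, z, hz₁, hz₂, not_finite_star_of_forall_unfolded h37 (K₁ ⊓ K₂) hCc hne m z hunf, hunf⟩

/-- ★★ **At a LOCALLY FINITE Thm-3.7 graph, two compact subgroups of `π₁^temp(𝒢)` meeting non-trivially generate a
compact subgroup or are ANCHORED** (verticially contained, intersection edge-like contained): the third regime of
the trichotomy needs a base vertex of infinite valence. [cite: MochizukiSemiAnbd2006, Thm 3.7(iv) p.41] -/
theorem isCompact_or_anchored_of_isLocallyFinite (h37 : 𝒢.Thm37Hypotheses) (hlf : 𝒢.graph.IsLocallyFinite)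
    (K₁ K₂ : Subgroup ((𝒢.galoisLevelData h37.toProp36Hypotheses).temperedPi h37.toProp36Hypotheses.isCountable))
    (hK₁ : IsCompact (K₁ : Set ((𝒢.galoisLevelData h37.toProp36Hypotheses).temperedPi
      h37.toProp36Hypotheses.isCountable)))
    (hK₂ : IsCompact (K₂ : Set ((𝒢.galoisLevelData h37.toProp36Hypotheses).temperedPi
      h37.toProp36Hypotheses.isCountable)))
    (hne : K₁ ⊓ K₂ ≠ ⊥) :
    IsCompact (((K₁ ⊔ K₂).topologicalClosure :
      Subgroup ((𝒢.galoisLevelData h37.toProp36Hypotheses).temperedPi h37.toProp36Hypotheses.isCountable)) :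
        Set ((𝒢.galoisLevelData h37.toProp36Hypotheses).temperedPi h37.toProp36Hypotheses.isCountable)) ∨
    ((∃ (v : 𝒢.graph.Vertex) (H : Subgroup (𝒢.temperedPiChart h37.toProp36Hypotheses).G),
        H ∈ verticialSubgroups (𝒢.temperedPiChart h37.toProp36Hypotheses) v ∧ K₁ ≤ H) ∧
      (∃ (v : 𝒢.graph.Vertex) (H : Subgroup (𝒢.temperedPiChart h37.toProp36Hypotheses).G),
        H ∈ verticialSubgroups (𝒢.temperedPiChart h37.toProp36Hypotheses) v ∧ K₂ ≤ H) ∧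
      ∃ (e : 𝒢.graph.Edge) (L : Subgroup (𝒢.temperedPiChart h37.toProp36Hypotheses).G),
        L ∈ edgeLikeSubgroups (𝒢.temperedPiChart h37.toProp36Hypotheses) e ∧ K₁ ⊓ K₂ ≤ L) := by
  by_cases hK : IsCompact (((K₁ ⊔ K₂).topologicalClosure :
      Subgroup ((𝒢.galoisLevelData h37.toProp36Hypotheses).temperedPi h37.toProp36Hypotheses.isCountable)) :
        Set ((𝒢.galoisLevelData h37.toProp36Hypotheses).temperedPi h37.toProp36Hypotheses.isCountable))
  · exact Or.inl hK
  · right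
    rcases anchored_or_infinite_valence_of_not_isCompact h37 K₁ K₂ hK₁ hK₂ hne hK with hanch | ⟨m, z, -, -, hinf, -⟩
    · exact hanch
    · exact absurd (𝒢.finite_branches_of_isLocallyFinite hlf _) hinf

end ProfiniteSemiGraph

end Literature.AnabelianGeometry.SemiGraphs

end
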